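import Summits.ABC.IUTFork.Joshi.TestIsmPartial
import Summits.ABC.IUTFork.Joshi.TestArithmeticoidsPinned
import HarnessLib

/-!
# Block E — COUNTERMODEL #3: the EVEN-POWER Ism (S false by PARITY, log-volume NOT invariant, a contentful located slot TRUE)

Record file (D-0012) of the abc-iut cell, block E «type Joshi's construction, test vs S» (rung LADDER-ABC:A2.E; seat abc-iut-E-cx-3,
THIRD block-E adversary / countermodel engine; CLAIM 2026-08-26T10:14:17Z). Target sentence S =
`Summit.ABC.IUTFork.Cor312Vol.PilotKummerIndRelated`; model of record of ¬S = `Cor312Vol.PinnedWitness.pinned_countermodel` (p419720).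

**The model.** `Joshi/TestIsmPartial` (E-t41's X-07′ model with the Ism field free) at `I := evenIsm p = {x ↦ ±p^{2k}·x | k ∈ ℤ}`.
Everything independent of Ism is inherited: the typed [IUTchIII] Thm. 3.11 (i) ∧ (ii) ∧ (iii) HOLDS, the three pins `PinnedRegions3` HOLD
for E-t41's operator `scalRegion` and the q-datum `{(±q)_j}`.

**Findings (kernel-checked; «typed ≠ proved»; no side taken).**
1. PARITY (`even_of_mem_closure`): every element of `⟨(Ind1) ∪ (Ind2)⟩` of the even shells acts on every packet line by a scalar
   of EVEN `p`-adic valuation ((Ind1) = signs and a permutation of the tensor factors, valuation `0`; (Ind2) = a product over the factors of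
   elements of `evenIsm`; closure under products and inverses). Hence the possible images of the Θ-region `B_{j²}` are EXACTLY the balls
   `B_{j²+2m}` (`evenSetting_possibleImages`), and at the label `j = 2` the q-region `B_1` is NOT among them (`1 − 4` is odd):
   **¬S** (`evenSetting_not_pilotKummerIndRelated`) — with all three pins holding.
2. **¬LogvolInvariant** (`evenSetting_not_logvolInvariant`): the (Ind2)-family `squareFamily` (`x ↦ p²·x` on the tensor factor `0`) IS an
   indeterminacy here and carries the admissible `B_0` onto `B_2` (log-volume `−2·log p ≠ 0`). So across models: volume-invariance FAILS and
   S FAILS together — `¬LogvolInvariant` is NECESSARY for S in the untilt-change form (abc-iut-E-cx's X-06 `not_untiltChange_of_logvolInvariant`)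
   but NOT SUFFICIENT; the coincidence «¬LogvolInvariant ⟺ S» over the two earlier models of record (pinned: invariant ∧ ¬S; X-07′: ¬invariant ∧ S)
   was an artefact of having two models.
3. A CONTENTFUL LOCATED SLOT IS TRUE HERE: the collation dictionary `squareDictionary` (every admissible identification of [J-III] §9.7.5 /
   [J-2½] Prop. 7.4.1 read as acting on our containers by `x ↦ p²·x`, `|p²| ≠ 1`) satisfies E-t18's `CollationInIsm` (`squareDictionary_collationInIsm`),
   while THE SAME DATA over the pinned carriers FALSIFY it (E-t58's `not_collationInIsm_of_rescaling`, instantiated: `pinnedSquareDictionary_not_collationInIsm`).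
   Both models have ¬S. So the truth value of the located slot («the move is realised inside Ism / ⟨Ind1 ∪ Ind2⟩») does NOT decide S, and
   «located slot TRUE at a ¬S model ⟹ the realisation is blind (signs)» (the pattern of every row of the pinned sweep) is an ARTEFACT of
   `Ism = signs` at p419720: what S needs is an indeterminacy of line-valuation EXACTLY `1 − j²` at every `j ∈ 𝔽_l^⋇` (X-07′ supplies it with
   `Ism = univ`; parity forbids it here although contentful rescalings abound).
Packaging: `even_countermodel` (typed Thm 3.11 ∧ PinnedRegions3 ∧ ¬LogvolInvariant ∧ contentful `CollationInIsm` ∧ `squareFamily ∈ ⟨Ind⟩`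
changing regions ∧ ¬S). Faithfulness of `Ism := evenIsm` to [IUTchIII] Prop. 1.2 (vi)/(vii) is NOT claimed (it is a probe, as `univ` was).
[claim: Mochizuki2012, status: disputed] [claim: Joshi2024ATS3, status: disputed] [cite: ScholzeStix2018, §2.2 pp. 9–10]
-/

noncomputable section

open Set

namespace Summit.ABC.IUTFork.Joshi.EvenScaling

open Thm311 Cor312 Cor312.Checks Cor312.IdentifiedNonVacuity Cor312Vol Cor312Vol.NaiveWitness Cor312Vol.PinnedWitness
  Literature.IUT.LogThetaLattice IsmScaling IsmPartial

universe u v w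

variable (p : ℕ)

/-! ## 0. The even-power Ism and its shells -/

/-- **The EVEN-POWER Ism** `{x ↦ ±p^{2k}·x | k ∈ ℤ}` — strictly between the signs of the model of record and E-t41's `univ`. [folklore] -/
def evenIsm : Set (ℚ ≃ₗ[ℚ] ℚ) :=
  {g | ∃ (s : ℚ) (k : ℤ), |s| = 1 ∧ ∀ x, g x = (s * (p : ℚ) ^ (2 * k)) * x}

/-- `1 ∈ evenIsm`. [folklore] -/
theorem refl_mem_evenIsm : LinearEquiv.refl ℚ ℚ ∈ evenIsm p :=
  ⟨1, 0, abs_one, fun x => by simp⟩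

/-- The scaling by a unit `u = ±p^{2k}` is in `evenIsm`. [folklore] -/
theorem smulOfUnit_mem_evenIsm {u : ℚˣ} {s : ℚ} {k : ℤ} (hs : |s| = 1) (hu : (u : ℚ) = s * (p : ℚ) ^ (2 * k)) :
    LinearEquiv.smulOfUnit u ∈ evenIsm p :=
  ⟨s, k, hs, fun x => by rw [← hu]; rfl⟩

/-- `x ↦ p^{2k}·x` is in `evenIsm`. [folklore] -/
theorem ppowUnit_even_mem_evenIsm [Fact p.Prime] (k : ℤ) : LinearEquiv.smulOfUnit (ppowUnit p (2 * k)) ∈ evenIsm p :=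
  smulOfUnit_mem_evenIsm p (s := 1) (k := k) abs_one (by rw [one_mul]; rfl)

/-- `x ↦ 1·x` is in `evenIsm`. [folklore] -/
theorem smulOfUnit_one_mem_evenIsm : LinearEquiv.smulOfUnit (1 : ℚˣ) ∈ evenIsm p :=
  smulOfUnit_mem_evenIsm p (s := 1) (k := 0) abs_one (by simp)

/-- **The even shells / situation / full situation / setting**: `Joshi/TestIsmPartial` at `I := evenIsm`. [claim: Mochizuki2012, status: disputed] -/
abbrev evenShells : LogShells toyIndex := ismShells (evenIsm p) (refl_mem_evenIsm p)

/-- The situation. [claim: Mochizuki2012, status: disputed] -/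
abbrev evenSituation : Situation toyIndex := ismSituation p (evenIsm p) (refl_mem_evenIsm p)

/-- The full situation of the typed Thm. 3.11. [claim: Mochizuki2012, status: disputed] -/
abbrev evenFull : FullSituation toyIndex := ismFull p (evenIsm p) (refl_mem_evenIsm p)

/-- The setting of Cor. 3.12. [claim: Mochizuki2012, status: disputed] -/
abbrev evenSetting : Setting (evenSituation p) := ismSetting p (evenIsm p) (refl_mem_evenIsm p)

/-! ## 1. Parity: every indeterminacy of the even shells is a line scalar of EVEN valuation -/

/-
The property propagated through `⟨(Ind1) ∪ (Ind2)⟩` (written out in every statement, no named predicate; `Φ` is typed over the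
sign-shell packets — the packets of ALL line-shell models coincide — so that the line lemmas of the model of record apply verbatim):
  `∀ j vQ, ∃ ε : ℚ, ε ≠ 0 ∧ (∃ m : ℤ, padicValRat p ε = 2 * m) ∧ ∀ x, line j vQ (Φ j vQ x) = ε * line j vQ x`.
-/

/-- Signs have valuation `0`. [folklore] -/
theorem padicValRat_eq_zero_of_abs_eq_one {s : ℚ} (hs : |s| = 1) : padicValRat p s = 0 := by
  rcases abs_eq (zero_le_one) |>.1 hs with h | h
  · rw [h, padicValRat.one]
  · rw [h, padicValRat.neg, padicValRat.one]

/-- Acting by signs (`ActsBySigns` of the model of record) is acting by scalars of even valuation (`0`). [folklore] -/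
theorem even_of_actsBySigns {Φ : signShells.PacketAut} (h : ActsBySigns Φ) (j : toyIndex.Label) (vQ : toyIndex.VQ) :
    ∃ ε : ℚ, ε ≠ 0 ∧ (∃ m : ℤ, padicValRat p ε = 2 * m) ∧ ∀ x : signShells.Packet j vQ, line j vQ (Φ j vQ x) = ε * line j vQ x := by
  obtain ⟨ε, hε, hΦε⟩ := h.sign j vQ
  have hε0 : ε ≠ 0 := by intro h0; rw [h0, abs_zero] at hε; exact zero_ne_one hε
  exact ⟨ε, hε0, ⟨0, by rw [padicValRat_eq_zero_of_abs_eq_one p hε, mul_zero]⟩, hΦε⟩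

/-- **(Ind1)-elements of the even shells act by scalars of even valuation** (strip-automorphisms = signs; permutations of the tensor
factors are invisible on the line: `actsBySigns_of_mem_Ind1Family` of the model of record, by name). [folklore] -/
theorem even_of_mem_Ind1Family {Φ : signShells.PacketAut} (h : Φ ∈ (evenShells p).Ind1Family) (j : toyIndex.Label)
    (vQ : toyIndex.VQ) :
    ∃ ε : ℚ, ε ≠ 0 ∧ (∃ m : ℤ, padicValRat p ε = 2 * m) ∧ ∀ x : signShells.Packet j vQ, line j vQ (Φ j vQ x) = ε * line j vQ x :=
  even_of_actsBySigns p (actsBySigns_of_mem_Ind1Family h) j vQ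

/-- An element of `evenIsm` is a scalar of even valuation. [folklore] -/
theorem exists_scalar_of_mem_evenIsm [hp : Fact p.Prime] {g : ℚ ≃ₗ[ℚ] ℚ} (hg : g ∈ evenIsm p) :
    ∃ c : ℚ, c ≠ 0 ∧ (∃ m : ℤ, padicValRat p c = 2 * m) ∧ ∀ x, g x = c * x := by
  obtain ⟨s, k, hs, h⟩ := hg
  have hs0 : s ≠ 0 := by intro h0; rw [h0, abs_zero] at hs; exact zero_ne_one hs
  refine ⟨s * (p : ℚ) ^ (2 * k), mul_ne_zero hs0 (ppow_ne_zero p _), ⟨k, ?_⟩, h⟩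
  rw [padicValRat.mul hs0 (ppow_ne_zero p _), padicValRat_eq_zero_of_abs_eq_one p hs, padicValRat_ppow, zero_add]

/-- A summand-wise `evenIsm`-automorphism of the 1-packet (one-point fibre) is such a scalar. [folklore] -/
theorem summandwise_eq_smul_of_evenIsm [Fact p.Prime] (vQ : toyIndex.VQ)
    (g : ∀ v : toyIndex.Fibre vQ, signShells.carrier v.1 ≃ₗ[ℚ] signShells.carrier v.1) (hg : ∀ v, g v ∈ evenIsm p) :
    ∃ c : ℚ, c ≠ 0 ∧ (∃ m : ℤ, padicValRat p c = 2 * m) ∧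
      ∀ y : signShells.Packet1 vQ, signShells.summandwise vQ g y = c • y := by
  haveI := toyFibreUnique vQ
  obtain ⟨c, hc, hm, hgc⟩ := exists_scalar_of_mem_evenIsm p (hg default)
  refine ⟨c, hc, hm, fun y => ?_⟩
  funext v
  rw [Unique.eq_default v]
  exact hgc _

/-- **(Ind2)-elements of the even shells act by scalars of even valuation**: the line scalar is the product over the tensor factors of
scalars of even valuation (multilinearity, `line_factorwise_of_smul` of the model of record). [folklore] -/
theorem even_of_mem_Ind2Family [Fact p.Prime] {Φ : signShells.PacketAut} (h : Φ ∈ (evenShells p).Ind2Family)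
    (j : toyIndex.Label) (vQ : toyIndex.VQ) :
    ∃ ε : ℚ, ε ≠ 0 ∧ (∃ m : ℤ, padicValRat p ε = 2 * m) ∧ ∀ x : signShells.Packet j vQ, line j vQ (Φ j vQ x) = ε * line j vQ x := by
  obtain ⟨g, hmem, hΦ⟩ := h j vQ
  have hs : ∀ i, ∃ c : ℚ, c ≠ 0 ∧ (∃ m : ℤ, padicValRat p c = 2 * m) ∧
      ∀ y : signShells.Packet1 vQ, signShells.summandwise vQ (g i) y = c • y :=
    fun i => summandwise_eq_smul_of_evenIsm p vQ (g i) fun v => hmem i v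
  choose c hc0 hcm hcs using hs
  have hprod : (∏ i, c i) ≠ 0 ∧ ∃ m : ℤ, padicValRat p (∏ i, c i) = 2 * m := by
    refine Finset.prod_induction c (fun x => x ≠ 0 ∧ ∃ m : ℤ, padicValRat p x = 2 * m) ?_ ⟨one_ne_zero, 0, by simp⟩
      fun i _ => ⟨hc0 i, hcm i⟩
    rintro a b ⟨ha, m, hm⟩ ⟨hb, n, hn⟩
    exact ⟨mul_ne_zero ha hb, m + n, by rw [padicValRat.mul ha hb, hm, hn]; ring⟩
  refine ⟨∏ i, c i, hprod.1, hprod.2, fun x => ?_⟩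
  have hΦ' : Φ j vQ = signShells.factorwise j vQ fun i => signShells.summandwise vQ (g i) := hΦ
  rw [hΦ', line_factorwise_of_smul j vQ _ c hcs]

/-- **PARITY: every element of `⟨(Ind1) ∪ (Ind2)⟩` of the even shells acts on every packet line by a scalar of EVEN valuation**
(closure induction: valuations add under products, change sign under inverses). [folklore] -/
theorem even_of_mem_closure [Fact p.Prime] {Φ : signShells.PacketAut}
    (h : Φ ∈ Subgroup.closure ((evenShells p).Ind1Family ∪ (evenShells p).Ind2Family)) (j : toyIndex.Label) (vQ : toyIndex.VQ) :
    ∃ ε : ℚ, ε ≠ 0 ∧ (∃ m : ℤ, padicValRat p ε = 2 * m) ∧ ∀ x : signShells.Packet j vQ, line j vQ (Φ j vQ x) = ε * line j vQ x := by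
  induction h using Subgroup.closure_induction with
  | mem Ψ hΨ =>
    rcases hΨ with h1 | h2
    · exact even_of_mem_Ind1Family p h1 j vQ
    · exact even_of_mem_Ind2Family p h2 j vQ
  | one => exact ⟨1, one_ne_zero, ⟨0, by simp⟩, fun x => by rw [one_mul]; rfl⟩
  | mul Ψ Ψ' _ _ hΨ hΨ' =>
    obtain ⟨ε, hε, ⟨m, hm⟩, hΨε⟩ := hΨ
    obtain ⟨δ, hδ, ⟨n, hn⟩, hΨδ⟩ := hΨ'
    refine ⟨ε * δ, mul_ne_zero hε hδ, ⟨m + n, ?_⟩, fun x => ?_⟩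
    · rw [padicValRat.mul hε hδ, hm, hn]; ring
    · show line j vQ (Ψ j vQ (Ψ' j vQ x)) = _
      rw [hΨε, hΨδ, mul_assoc]
  | inv Ψ _ hΨ =>
    obtain ⟨ε, hε, ⟨m, hm⟩, hΨε⟩ := hΨ
    refine ⟨ε⁻¹, inv_ne_zero hε, ⟨-m, ?_⟩, fun x => ?_⟩
    · rw [padicValRat.inv, hm]; ring
    · show line j vQ ((Ψ j vQ).symm x) = _
      have h := hΨε ((Ψ j vQ).symm x)
      rw [LinearEquiv.apply_symm_apply] at h
      rw [h, ← mul_assoc, inv_mul_cancel₀ hε, one_mul]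

/-- … hence carries `B_k` onto some `B_{k+2m}`. [folklore] -/
theorem image_pBall_of_mem_closure [Fact p.Prime] {Φ : signShells.PacketAut}
    (h : Φ ∈ Subgroup.closure ((evenShells p).Ind1Family ∪ (evenShells p).Ind2Family)) (j : toyIndex.Label) (vQ : toyIndex.VQ)
    (k : ℤ) : ∃ m : ℤ, Φ j vQ '' pBall p j vQ k = pBall p j vQ (k + 2 * m) := by
  obtain ⟨ε, hε, ⟨m, hm⟩, hΦ⟩ := even_of_mem_closure p h j vQ
  exact ⟨m, by rw [image_pBall_of_scalar p hε hΦ k, hm]⟩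

/-! ## 2. The contentful (Ind2)-families `x ↦ p^{2m}·x` on the tensor factor `0` -/

/-- **The `p^{2m}`-family**: E-t41's `scaleFamily` at the constant unit `p^{2m}` (on every summand of the factor `0`, identity elsewhere). [folklore] -/
def evenFamily [Fact p.Prime] (m : ℤ) : (evenShells p).PacketAut := scaleFamily fun _ => ppowUnit p (2 * m)

/-- `evenFamily m` IS an (Ind2)-family of the even shells. [folklore] -/
theorem evenFamily_mem_Ind2Family [Fact p.Prime] (m : ℤ) : evenFamily p m ∈ (evenShells p).Ind2Family := fun j _ => by
  refine ⟨fun i _ => LinearEquiv.smulOfUnit (factorUnits j (ppowUnit p (2 * m)) i), fun i _ => ?_, rfl⟩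
  refine Fin.cases ?_ (fun i' => ?_) i
  · exact ppowUnit_even_mem_evenIsm p m
  · show LinearEquiv.smulOfUnit (1 : ℚˣ) ∈ evenIsm p
    exact smulOfUnit_one_mem_evenIsm p

/-- … hence lies in `⟨(Ind1) ∪ (Ind2)⟩ = indGroup` of the even situation. [folklore] -/
theorem evenFamily_mem_indGroup [Fact p.Prime] (m : ℤ) : evenFamily p m ∈ Setting.indGroup (evenSituation p) :=
  Subgroup.subset_closure (Set.mem_union_right _ (evenFamily_mem_Ind2Family p m))

/-- `evenFamily m` carries `B_k` onto `B_{k+2m}`. [folklore] -/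
theorem image_pBall_evenFamily [Fact p.Prime] (m : ℤ) (j : toyIndex.Label) (vQ : toyIndex.VQ) (k : ℤ) :
    evenFamily p m j vQ '' pBall p j vQ k = pBall p j vQ (k + 2 * m) := by
  have h := image_pBall_scaleFamily p (fun _ => ppowUnit p (2 * m)) j vQ k
  have e : padicValRat p ((ppowUnit p (2 * m) : ℚˣ) : ℚ) = 2 * m := padicValRat_ppow p (2 * m)
  rw [e] at h
  exact h

/-- **`squareFamily := evenFamily 1`** (`x ↦ p²·x` on the factor `0`): a CONTENTFUL indeterminacy of the even shells. [folklore] -/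
abbrev squareFamily [Fact p.Prime] : (evenShells p).PacketAut := evenFamily p 1

variable [hp : Fact p.Prime]

/-! ## 3. The possible images are the balls `B_{j²+2m}`; ¬S by parity at `j = 2` -/

/-- **THE POSSIBLE IMAGES OF THE Θ-REGION AT `j ∈ 𝔽_l^⋇` ARE EXACTLY THE BALLS `B_{j²+2m}`** (parity ⟸ `even_of_mem_closure`;
every such ball ⟸ `evenFamily m`). Model of record: `{B_{j²}}`; X-07′: all balls. [folklore] -/
theorem evenSetting_possibleImages {j : toyIndex.Label} (hj : j ≠ 0) (vQ : toyIndex.VQ) :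
    (evenSetting p).possibleImages j vQ = {U | ∃ m : ℤ, U = pBall p j vQ (jsq j + 2 * m)} := by
  ext U
  rw [mem_possibleImages_iff p _ _ hj]
  constructor
  · rintro ⟨Φ, hΦ, rfl⟩
    exact image_pBall_of_mem_closure p hΦ j vQ (jsq j)
  · rintro ⟨m, rfl⟩
    exact ⟨evenFamily p m, evenFamily_mem_indGroup p m, (image_pBall_evenFamily p m j vQ (jsq j)).symm⟩

/-- **At the label `j = 2` the q-region `B_1` is NOT a possible image of the Θ-region `B_4`**: `1 = 4 + 2m` has no solution. [folklore] -/
theorem evenSetting_qRegion_not_mem_possibleImages (vQ : toyIndex.VQ) :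
    (evenSetting p).qRegion (Setting.labelSucc ⟨1, one_lt_lstar⟩) vQ ∉
      (evenSetting p).possibleImages (Setting.labelSucc ⟨1, one_lt_lstar⟩) vQ := by
  rw [evenSetting_possibleImages p (Setting.labelSucc_ne_zero _), ismSetting_qRegion_of_ne_zero p _ _ (Setting.labelSucc_ne_zero _)]
  rintro ⟨m, h⟩
  have h4 : jsq (Setting.labelSucc ⟨1, one_lt_lstar⟩ : toyIndex.Label) = 4 := rfl
  rw [h4] at h
  have := pBall_injective p _ vQ h
  omega

/-- **¬S AT THE EVEN MODEL** — `PilotKummerIndRelated` FAILS although all three pins hold and contentful rescalings are indeterminacies: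
no element of `⟨(Ind1) ∪ (Ind2)⟩` has line-valuation `1 − j² = −3` at `j = 2`. [claim: Mochizuki2012, status: disputed] -/
theorem evenSetting_not_pilotKummerIndRelated :
    ¬ Summit.ABC.IUTFork.Cor312Vol.PilotKummerIndRelated (evenFull p).toLatticeSituation (evenSetting p) (scalRegion p) (qDatum p) :=
  fun h => evenSetting_qRegion_not_mem_possibleImages p ()
    ((pilotKummerIndRelated_iff p (evenIsm p) (refl_mem_evenIsm p)).1 h _ ())

/-! ## 4. Log-volume is NOT invariant under the indeterminacies -/

/-- **¬LogvolInvariant**: the (Ind2)-family `squareFamily` carries the admissible `B_0` (log-volume `0`) onto `B_2` (log-volume `−2·log p`)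
at the label `1`. [folklore] -/
theorem evenSetting_not_logvolInvariant : ¬ ((evenFull p).D (evenSetting p).n).LogvolInvariant := fun h => by
  have key : ∀ vQ : toyIndex.VQ, False := fun vQ => by
    have h0 := h (squareFamily p) (Or.inr (evenFamily_mem_Ind2Family p 1)) 1 vQ (pBall p 1 vQ 0) (Or.inr ⟨0, rfl⟩)
    have himg := image_pBall_evenFamily p 1 1 vQ 0
    have h1 : pVol p 1 vQ (pBall p 1 vQ (0 + 2 * 1)) = pVol p 1 vQ (pBall p 1 vQ 0) := by
      rw [← himg]; exact h0
    rw [pVol_pBall, pVol_pBall] at h1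
    have := log_p_pos p
    push_cast at h1
    linarith
  exact key ()

/-! ## 5. A contentful located slot is TRUE here and FALSE at the pinned carriers — both models have ¬S -/

open ATS3

variable {Y : Type u} {V : Type v} {H : Y → V → Type w} (C : ClassCollationDatum Y V H) (placeOf : V → toyIndex.V)

/-- **The p²-collation dictionary** over the even shells: every admissible identification `φ ∈ C.iso y w` ([J-III] §9.7.5 / [J-2½] Prop. 7.4.1,
E-t38's readings N ⊆ W) is read as acting on each of our containers by the genuine rescaling `x ↦ p²·x`. [claim: Joshi2024ATS3, status: disputed] -/
def squareDictionary : CollationDictionary C (evenFull p).toLatticeSituation.L :=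
  ⟨placeOf, fun _ _ _ _ _ _ => LinearEquiv.smulOfUnit (ppowUnit p 2)⟩

/-- THE SAME DATA over the pinned carriers of the model of record. [claim: Joshi2024ATS3, status: disputed] -/
def pinnedSquareDictionary : CollationDictionary C (naiveFull p).toLatticeSituation.L :=
  ⟨placeOf, fun _ _ _ _ _ _ => LinearEquiv.smulOfUnit (ppowUnit p 2)⟩

/-- The dictionaries are CONTENTFUL: every induced container automorphism is `x ↦ p²·x`. [folklore] -/
theorem squareDictionary_apply (y : Y) (w : V) (φ : ↥(C.iso y w)) (j : toyIndex.Label) (i : toyIndex.Caps j) (w' : toyIndex.V)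
    (x : ℚ) : (squareDictionary p C placeOf).isoAut y w φ j i w' x = (p : ℚ) ^ (2 : ℤ) * x := rfl

/-- (the same over the pinned carriers). [folklore] -/
theorem pinnedSquareDictionary_apply (y : Y) (w : V) (φ : ↥(C.iso y w)) (j : toyIndex.Label) (i : toyIndex.Caps j)
    (w' : toyIndex.V) (x : ℚ) : (pinnedSquareDictionary p C placeOf).isoAut y w φ j i w' x = (p : ℚ) ^ (2 : ℤ) * x := rfl

/-- `|p²| ≠ 1`. [folklore] -/
theorem abs_ppow_two_ne_one : |(p : ℚ) ^ (2 : ℤ)| ≠ 1 := by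
  have h2 : (2 : ℚ) ≤ p := by exact_mod_cast hp.out.two_le
  rw [abs_of_pos (zpow_pos (by linarith) _)]
  have : (4 : ℚ) ≤ (p : ℚ) ^ (2 : ℤ) := by rw [zpow_two]; nlinarith
  linarith

/-- **`CollationInIsm` HOLDS for the contentful dictionary at the even model** (`p² ∈ evenIsm`). [claim: Joshi2024ATS3, status: disputed] -/
theorem squareDictionary_collationInIsm : (squareDictionary p C placeOf).CollationInIsm := fun _ _ _ _ _ _ => by
  show LinearEquiv.smulOfUnit (ppowUnit p 2) ∈ evenIsm p
  have h := ppowUnit_even_mem_evenIsm p 1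
  rwa [mul_one] at h

/-- **… and FAILS for the same data at the pinned carriers** (E-t58's `not_collationInIsm_of_rescaling`, `|p²| ≠ 1`), PROVIDED an admissible
identification exists at all (else every located `Prop` holds vacuously there). [claim: Joshi2024ATS3, status: disputed] -/
theorem pinnedSquareDictionary_not_collationInIsm {y : Y} {w : V} (φ : ↥(C.iso y w)) :
    ¬ (pinnedSquareDictionary p C placeOf).CollationInIsm :=
  (pinnedSquareDictionary p C placeOf).not_collationInIsm_of_rescaling p (j := 0) (i := 0) (w' := ()) (φ := φ)
    (abs_ppow_two_ne_one p) (pinnedSquareDictionary_apply p C placeOf y w φ 0 0 ())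

/-! ## 6. Packaging: COUNTERMODEL #3 -/

/-- **COUNTERMODEL #3 (even-power Ism).** In ONE lattice situation: the typed [IUTchIII] Thm. 3.11 HOLDS; the three pins `PinnedRegions3` HOLD;
log-volume is NOT invariant under (Ind1) ∪ (Ind2); the contentful indeterminacy `squareFamily ∈ ⟨(Ind1) ∪ (Ind2)⟩` MOVES regions
(`B_k ↦ B_{k+2}`); the contentful collation dictionary satisfies the located `CollationInIsm`; and S = `PilotKummerIndRelated` FAILS.
[claim: Mochizuki2012, status: disputed] -/
theorem even_countermodel :
    (evenFull p).Statement ∧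
    Summit.ABC.IUTFork.Cor312Vol.PinnedRegions3 (evenFull p).toLatticeSituation (evenSetting p) (scalRegion p) (qDatum p) ∧
    ¬ ((evenFull p).D (evenSetting p).n).LogvolInvariant ∧
    (squareFamily p ∈ Setting.indGroup (evenSituation p) ∧
      ∀ (j : toyIndex.Label) (vQ : toyIndex.VQ) (k : ℤ), squareFamily p j vQ '' pBall p j vQ k = pBall p j vQ (k + 2)) ∧
    ((squareDictionary p C placeOf).CollationInIsm ∧
      ∀ y w (φ : ↥(C.iso y w)) j i w' (x : ℚ), (squareDictionary p C placeOf).isoAut y w φ j i w' x = (p : ℚ) ^ (2 : ℤ) * x) ∧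
    |(p : ℚ) ^ (2 : ℤ)| ≠ 1 ∧
    ¬ Summit.ABC.IUTFork.Cor312Vol.PilotKummerIndRelated (evenFull p).toLatticeSituation (evenSetting p) (scalRegion p) (qDatum p) :=
  ⟨ismFull_statement p _ _, ismSetting_pinnedRegions3 p _ _, evenSetting_not_logvolInvariant p,
    ⟨evenFamily_mem_indGroup p 1, fun j vQ k => by
      show evenFamily p 1 j vQ '' pBall p j vQ k = _
      rw [image_pBall_evenFamily, mul_one]⟩,
    ⟨squareDictionary_collationInIsm p C placeOf, squareDictionary_apply p C placeOf⟩, abs_ppow_two_ne_one p,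
    evenSetting_not_pilotKummerIndRelated p⟩

/-- **The three models side by side** (all: typed Thm 3.11 ∧ PinnedRegions3): pinned carriers (`Ism = signs`) — LogvolInvariant ∧ ¬S;
X-07′ (`Ism = univ`) — ¬LogvolInvariant ∧ S; even (`Ism = {±p^{2k}}`) — ¬LogvolInvariant ∧ ¬S. So `¬LogvolInvariant` does not imply S.
[claim: Mochizuki2012, status: disputed] -/
theorem not_logvolInvariant_and_not_pilotKummerIndRelated :
    (¬ ((evenFull p).D (evenSetting p).n).LogvolInvariant ∧
      ¬ Summit.ABC.IUTFork.Cor312Vol.PilotKummerIndRelated (evenFull p).toLatticeSituation (evenSetting p) (scalRegion p) (qDatum p)) ∧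
    (¬ ((scalFull p).D (scalSetting p).n).LogvolInvariant ∧
      Summit.ABC.IUTFork.Cor312Vol.PilotKummerIndRelated (scalFull p).toLatticeSituation (scalSetting p) (scalRegion p) (qDatum p)) :=
  ⟨⟨evenSetting_not_logvolInvariant p, evenSetting_not_pilotKummerIndRelated p⟩,
    ⟨scalSetting_not_logvolInvariant p, scalSetting_pilotKummerIndRelated p⟩⟩

end Summit.ABC.IUTFork.Joshi.EvenScaling

end
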